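import Summits.QuantumFields.BalabanUV.Beta.SymRootedGaugeCovariance
import Summits.QuantumFields.BalabanUV.Beta.SymRootedMixedJetContact
import Summits.QuantumFields.BalabanUV.Beta.MixedJetWard

/-!
# `BalabanUV.Beta.SymMixedJetWard` — THE JET WARD IDENTITY OF THE (0.4)-SYMMETRISED ROOTED MIXED JET `symMjetAt ρ` (β sub-cell, row D1,
# TABLES-SYM-LEAN S2c, INTERFACE-LEVEL twin «MIXED-JET-WARDσ» of an2-g21's `MixedJetWard`; an1 gen 43; the Ward path to (T2-M₂))

HONEST FRAMING (cell charter, verbatim): «discharging BetaPertH makes Bałaban's UV stability UNCONDITIONAL — a real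
constructive-QFT result; it is NOT the continuum limit and NOT the Clay problem.»  HONEST DEPENDENCY (verbatim): «continuum YM on
T⁴ ⇐ BetaPertH ∧ nine spine estimates (0/9 proved); BetaPertH ⇐ (D1) ∧ (D4) ∧ CAP+tail; G-an2-4 gates asym, D1 and NE2/3/4.»
ABSOLUTE RULE (R-g25-7 ∕ R-D1-g30-1 (A)): the (0.4)-symmetrised averaging is the exp of the MEAN OF LOGS over the pair family
`{loop^{σ,σ′}}` with weight `((d!)²·L^d)⁻¹`; every object below is the comb module's algebra read on an1's `symPhiGAt` (S2b part 1)
instead of `PhiGAt` — STATEMENT FOR STATEMENT under the dictionary `PhiXAt ↦ symPhiXAt`, `XjetAt ↦ symXjetAt`, `MσXAt ↦ symMσXAt`,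
`L^{-d}·linAvgAt ↦ (d!·L^d)⁻¹·symLinU`, `L^{-d}·hessUAt ↦ ((d!)²L^d)⁻¹·symHessUAt`, `L^{-2d}·vhUAt ↦ ((d!)²L^{2d})⁻¹·symVhUAt`
(an3-g63 [AN3-G63-S2C] (C-ii): constants PER BCH ORDER; CONVENTION `(d!)²` un-normalised inside order-2 sym functionals).
FAMILY-INDEPENDENT chart ∕ letter ∕ `Tau`-algebra lemmas of the comb module are imported BY NAME, never re-proved.
DERIVED cell leaf: [folklore] ring algebra; the `sym*` families are [our object]s.  No statement of Bałaban's papers is typed here, no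
`[cite:]` tag, no `Prop` is minted, no binder of the β-function wall (`hW`/`hR`/`D1Tel`/`D1Rep`, (D1), `BetaPertH`) is instantiated or
discharged; nothing about the VALUES of `symMixFFAt`∕`symVh₂SAt` and no (T2-B)∕(T2-M₂) letter is discharged in this file.
NOT D1, NOT BetaPertH, NOT continuum, NOT Clay.  NOT summit progress.
Provenance: β sub-cell, TABLES-SYM-LEAN S2c option (C) (S2C-SCOPE-v1 94facb80ac685517), unit b2b-balaban-beta-an1-g43 (W-supplier AN1,
FREEZE (0): scratch for a courier; an1 files nothing), 2026-08-21; no existing file touched.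

## What this module proves (sym twin of `MixedJetWard` §3–§5; the gauge pair `ug`∕`ugb`, the letters `dS`, `βg`, `βg1∕2∕3`, the chart lemmas
## `gaugeF_GmL`∕`gaugeB_GmbL` and the `Rho`-algebra lemmas `invT_conj_gauge`∕`logT_quot_gauge`∕`snd_conj_ug` are the comb module's, BY NAME)
* §3 `symPhiMLAt_gauge` (an1's G1σ `symPhiGAt_gauge` on the mixed left chart), `symPhiMLAt_gauge_ref`, `augR_symPhiMLAt`.
* §4 **`symMσLAt_dS`**: `symMσLAt ρ Z Z̄ Z₀ Z̄₀ dS = symMσGAt ρ Z Z̄ βg Z₀ Z̄₀ 0 − (ι(λ r•D)·J₀ − J₀·ι(λ r•D))`, `J₀ = logT symΦ^ρ(Zf W V, Zb W V)`.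
* §5 `c11_symMσGAt_βg` and **`symMjetAt_gauge_counts`**: `symM^ρ_b(W, V; dλ·D) = (2(d!)²L^d)⁻¹•(symHessUAt ρ V β₁ + d!•symLinU ρ [V,β₁] + symHessUAt ρ W β₂
  + d!•symLinU ρ [W,β₂]) + (d!·L^d)⁻¹•symLinU ρ β₃ − (a_r·H − H·a_r)`, `H = (2(d!)²L^d)⁻¹•symHessUAt ρ W V`.
-/

namespace Summit.QuantumFields.BalabanUV.Beta.SymMixedJetWard

open Finset
open scoped Nat
open Literature.MathematicalPhysics.QuantumFieldTheory.Balaban1983to89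
open Literature.MathematicalPhysics.QuantumFieldTheory.Balaban1983to89.Beta
open AffineAveraging (Form1 box unitVec)
open AveragingContoursRooted (ctr)
open AveragingHessianKernels (bw)
open AveragingThirdJet (Tau Rho dmk fst_dmk snd_dmk dfst_mul dsnd_mul upF upF_apply logT invT expT map_logT map_invT invT_one logT_one
  ι_zero augR augR_apply gaugeF gaugeB logT_conj)
open AveragingThirdJet.Tau (τ₁ τ₂ τ12 ι c00 c10 c01 c11 mk ext4 c11_add c11_neg c11_sub c11_smul c00_mk c10_mk c01_mk c11_mk c00_ι c11_ι_mul c11_mul_ι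
  c11_τ₁_mul c11_τ₂_mul c11_τ12_mul τ₁_comm τ₂_comm τ12_comm c00_mul c10_mul c01_mul c11_mul c00_one)
open AveragingMixedJetTables (Zf Zb)
open Summit.QuantumFields.BalabanUV.Beta.TruncatedNil4Calculus (nil4_augR mul_invT_eq_one eq_invT_of_mul_eq_one)
open Summit.QuantumFields.BalabanUV.Beta.RootedMixedChartReflection (GmL GmbL fst_GmL snd_GmL fst_GmbL snd_GmbL Zf_mul_Zb Zb_mul_Zf
  Zb_mul_ι_mul_Zf)
open Summit.QuantumFields.BalabanUV.Beta.SymRootedMixedJetLinear (symMσGAt symMσLAt_eq_symMσGAt symMσGAt_eq_symMσLAt_add symMσLAt_sub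
  symMσGAt_add_zero symMσGAt_mul_central_zero)
open Summit.QuantumFields.BalabanUV.Beta.RootedMixedJetReflectionLaw (Zf_zero Zb_zero fst_logT mk_sub_ι)
open Summit.QuantumFields.BalabanUV.Beta.SymRootedMixedJetReflectionLaw (fst_symPhiMLAt)
open Summit.QuantumFields.BalabanUV.Beta.SymRootedMixedJetContact (c10_symMσGAt_contact c01_symMσGAt_contact c00_symMσGAt_contact)
open Summit.QuantumFields.BalabanUV.Beta.SymRootedGaugeCovariance (symPhiGAt_gauge)
open Summit.QuantumFields.BalabanUV.Beta.SymRootedJetDictionary (aug_symPhiGAt_eq_one c11_logT_symPhiGAt_Zf)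
open Summit.QuantumFields.BalabanUV.Beta.MixedJetWard (ug ugb dS βg ug_mul_ugb ugb_mul_ug augR_ug augR_ugb βg_zero_zero ι_sub dS_apply gaugeF_GmL gaugeB_GmbL
  augR_GmL_Zf augR_GmbL_Zb invT_conj_gauge logT_quot_gauge snd_conj_ug βg1 βg2 βg3 βg_eq dS_eq_upF)
open Summit.QuantumFields.BalabanUV.Beta.SymAveragingHessianCounts (symLinU symHessUAt)
open Summit.QuantumFields.BalabanUV.Beta.SymAveragingMixedJetTables (symPhiGAt map_symPhiGAt symPhiGAt_one symMjetAt)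
open Summit.QuantumFields.BalabanUV.Beta.SymRootedMixedChartReflection (symPhiMLAt symMσLAt symMjetAt_eq_symMjetLAt symMjetLAt_eq_c11)

variable {𝕜 : Type*} [Field 𝕜] {d : ℕ} {𝔸 : Type*} [Ring 𝔸] [Algebra 𝕜 𝔸]

/-! ## §1 The gauge pair, the pure-gauge background and the letter-rotation defect -/

variable (lam : (Fin d → ℤ) → 𝕜) (D : 𝔸)

/-! ## §2 The gauge-transformed mixed left chart is a mixed left chart -/

/-! ## §3 The mother identity on the mixed left chart and the conjugated quotient -/

/-- [folklore] **THE MOTHER IDENTITY ON THE MIXED LEFT CHART**: `Φ^L_ρ(Z, Z̄; b − dS + βg) = u(r)·Φ^L_ρ(Z, Z̄; b)·ū(r + L·e_μ)`, `r = L·y + ρ`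
(G1 `symPhiGAt_gauge` over `Rho 𝔸` + §2). -/
theorem symPhiMLAt_gauge (h2 : (2 : 𝕜) ≠ 0) (ρ : Fin d → ℤ) (W V : Form1 d 𝔸) (b : Form1 d (Tau 𝔸)) (L : ℕ) (μ : Fin d) (y : Fin d → ℤ) :
    symPhiMLAt 𝕜 ρ (Zf 𝕜 W V) (Zb 𝕜 W V) (b - dS lam D + βg lam D W V) L μ y
      = ug lam D ((L : ℤ) • y + ρ) * symPhiMLAt 𝕜 ρ (Zf 𝕜 W V) (Zb 𝕜 W V) b L μ y * ugb lam D ((L : ℤ) • y + ρ + (L : ℤ) • unitVec μ) := by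
  rw [symPhiMLAt, symPhiMLAt, ← gaugeF_GmL lam D h2 W V b, ← gaugeB_GmbL lam D h2 W V b]
  exact symPhiGAt_gauge (ug_mul_ugb lam D) (ugb_mul_ug lam D) ρ L μ y

/-- [folklore] The reference case `W = V = 0`: `Φ^L_ρ(1, 1; b − dS) = u(r)·Φ^L_ρ(1, 1; b)·ū(r′)`. -/
theorem symPhiMLAt_gauge_ref (h2 : (2 : 𝕜) ≠ 0) (ρ : Fin d → ℤ) (b : Form1 d (Tau 𝔸)) (L : ℕ) (μ : Fin d) (y : Fin d → ℤ) :
    symPhiMLAt 𝕜 ρ (Zf 𝕜 (0 : Form1 d 𝔸) 0) (Zb 𝕜 (0 : Form1 d 𝔸) 0) (b - dS lam D) L μ y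
      = ug lam D ((L : ℤ) • y + ρ) * symPhiMLAt 𝕜 ρ (Zf 𝕜 (0 : Form1 d 𝔸) 0) (Zb 𝕜 (0 : Form1 d 𝔸) 0) b L μ y
        * ugb lam D ((L : ℤ) • y + ρ + (L : ℤ) • unitVec μ) := by
  have h := symPhiMLAt_gauge lam D h2 ρ (0 : Form1 d 𝔸) 0 b L μ y
  rwa [βg_zero_zero, add_zero] at h

/-- [folklore] The mixed left-chart averaging over `Zf W V` has augmentation one (so its truncated inverse is exact; leaf-05's `nil4_augR`). -/
theorem augR_symPhiMLAt (ρ : Fin d → ℤ) (W V : Form1 d 𝔸) (b : Form1 d (Tau 𝔸)) (L : ℕ) (μ : Fin d) (y : Fin d → ℤ) :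
    augR 𝕜 (symPhiMLAt 𝕜 ρ (Zf 𝕜 W V) (Zb 𝕜 W V) b L μ y) = 1 :=
  aug_symPhiGAt_eq_one (augR_GmL_Zf W V b) (augR_GmbL_Zb W V b) ρ L μ y

/-! ## §4 The σ-jet Ward identity (every `τ`-degree) -/

/-- [folklore] **THE σ-JET WARD IDENTITY OF THE MIXED LEFT CHART** (every `τ`-degree): for `Z = Zf W V`, `Z̄ = Zb W V`, reference `Z₀ = Z̄₀ = 1`
(`= Zf 0 0`, `Zb 0 0`) and any background `b`,
`symMσLAt ρ Z Z̄ Z₀ Z̄₀ dS = symMσGAt ρ Z Z̄ βg Z₀ Z̄₀ 0 − (ι(λ r•D)·J₀ − J₀·ι(λ r•D))`, `J₀ = logT Φ^ρ(Zf W V, Zb W V)`. -/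
theorem symMσLAt_dS (h2 : (2 : 𝕜) ≠ 0) (ρ : Fin d → ℤ) (W V : Form1 d 𝔸) (b : Form1 d (Tau 𝔸)) (L : ℕ) (μ : Fin d) (y : Fin d → ℤ) :
    symMσLAt 𝕜 ρ (Zf 𝕜 W V) (Zb 𝕜 W V) (Zf 𝕜 0 0) (Zb 𝕜 0 0) (dS lam D) L μ y
      = symMσGAt 𝕜 ρ (Zf 𝕜 W V) (Zb 𝕜 W V) (βg lam D W V) (Zf 𝕜 0 0) (Zb 𝕜 0 0) 0 L μ y
        - (ι (lam ((L : ℤ) • y + ρ) • D) * logT 𝕜 (symPhiGAt 𝕜 ρ (Zf 𝕜 W V) (Zb 𝕜 W V) L μ y)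
           - logT 𝕜 (symPhiGAt 𝕜 ρ (Zf 𝕜 W V) (Zb 𝕜 W V) L μ y) * ι (lam ((L : ℤ) • y + ρ) • D)) := by
  -- the two-background σ-jet of the gauge-transformed pair, computed twice
  set r : Fin d → ℤ := (L : ℤ) • y + ρ with hr
  set r' : Fin d → ℤ := (L : ℤ) • y + ρ + (L : ℤ) • unitVec μ with hr'
  set Φ := symPhiMLAt 𝕜 ρ (Zf 𝕜 W V) (Zb 𝕜 W V) b L μ y with hΦ
  set Φ₀ := symPhiMLAt 𝕜 ρ (Zf 𝕜 (0 : Form1 d 𝔸) 0) (Zb 𝕜 (0 : Form1 d 𝔸) 0) b L μ y with hΦ₀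
  have key : symMσGAt 𝕜 ρ (Zf 𝕜 W V) (Zb 𝕜 W V) (b - dS lam D + βg lam D W V) (Zf 𝕜 0 0) (Zb 𝕜 0 0) (b - dS lam D) L μ y
      = (ug lam D r * logT 𝕜 (Φ * invT Φ₀) * ugb lam D r).snd := by
    rw [symMσGAt, symPhiMLAt_gauge lam D h2, symPhiMLAt_gauge_ref lam D h2, logT_quot_gauge lam D (augR_symPhiMLAt ρ 0 0 b L μ y)]
  -- left side: additivity in the two backgrounds
  have lhs : symMσGAt 𝕜 ρ (Zf 𝕜 W V) (Zb 𝕜 W V) (b - dS lam D + βg lam D W V) (Zf 𝕜 0 0) (Zb 𝕜 0 0) (b - dS lam D) L μ y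
      = symMσLAt 𝕜 ρ (Zf 𝕜 W V) (Zb 𝕜 W V) (Zf 𝕜 0 0) (Zb 𝕜 0 0) b L μ y
          - symMσLAt 𝕜 ρ (Zf 𝕜 W V) (Zb 𝕜 W V) (Zf 𝕜 0 0) (Zb 𝕜 0 0) (dS lam D) L μ y
          + symMσGAt 𝕜 ρ (Zf 𝕜 W V) (Zb 𝕜 W V) (βg lam D W V) (Zf 𝕜 0 0) (Zb 𝕜 0 0) 0 L μ y := by
    rw [symMσGAt_eq_symMσLAt_add, symMσLAt_sub]
  -- right side: the σ-part of the root conjugation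
  have rhs : (ug lam D r * logT 𝕜 (Φ * invT Φ₀) * ugb lam D r).snd
      = symMσLAt 𝕜 ρ (Zf 𝕜 W V) (Zb 𝕜 W V) (Zf 𝕜 0 0) (Zb 𝕜 0 0) b L μ y
          + (ι (lam r • D) * logT 𝕜 (symPhiGAt 𝕜 ρ (Zf 𝕜 W V) (Zb 𝕜 W V) L μ y)
              - logT 𝕜 (symPhiGAt 𝕜 ρ (Zf 𝕜 W V) (Zb 𝕜 W V) L μ y) * ι (lam r • D)) := by
    have hfst : (logT 𝕜 (Φ * invT Φ₀)).fst = logT 𝕜 (symPhiGAt 𝕜 ρ (Zf 𝕜 W V) (Zb 𝕜 W V) L μ y) := by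
      have h0 : Φ₀.fst = 1 := by rw [hΦ₀, fst_symPhiMLAt, Zf_zero, Zb_zero, symPhiGAt_one]
      rw [fst_logT, dfst_mul, hΦ, fst_symPhiMLAt,
        Summit.QuantumFields.BalabanUV.Beta.RootedMixedJetReflectionLaw.fst_invT_of_fst_eq_one h0, mul_one]
    rw [snd_conj_ug, hfst]
    have hsnd : (logT 𝕜 (Φ * invT Φ₀)).snd = symMσLAt 𝕜 ρ (Zf 𝕜 W V) (Zb 𝕜 W V) (Zf 𝕜 0 0) (Zb 𝕜 0 0) b L μ y := by
      rw [symMσLAt, hΦ, hΦ₀]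
    rw [hsnd]
    abel
  have h3 := key
  rw [lhs, rhs] at h3
  -- solve for the pure-gauge jet: from `A − X + G = A + C` get `X = G − C`
  set A := symMσLAt 𝕜 ρ (Zf 𝕜 W V) (Zb 𝕜 W V) (Zf 𝕜 0 0) (Zb 𝕜 0 0) b L μ y
  set X := symMσLAt 𝕜 ρ (Zf 𝕜 W V) (Zb 𝕜 W V) (Zf 𝕜 0 0) (Zb 𝕜 0 0) (dS lam D) L μ y
  set G := symMσGAt 𝕜 ρ (Zf 𝕜 W V) (Zb 𝕜 W V) (βg lam D W V) (Zf 𝕜 0 0) (Zb 𝕜 0 0) 0 L μ y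
  set C := ι (lam r • D) * logT 𝕜 (symPhiGAt 𝕜 ρ (Zf 𝕜 W V) (Zb 𝕜 W V) L μ y)
      - logT 𝕜 (symPhiGAt 𝕜 ρ (Zf 𝕜 W V) (Zb 𝕜 W V) L μ y) * ι (lam r • D)
  calc X = (A + C) - (A - X + G) + G - C := by abel
    _ = (A - X + G) - (A - X + G) + G - C := by rw [← h3]
    _ = G - C := by abel

/-! ## §5 The Ward identity of the `τ₁τ₂σ`-coefficient in counts -/

section Counts

/-- [folklore] **THE CONTACT EXPANSION OF THE ROTATION RESPONSE** (the twin of 33M2's `c11_symMσGAt_DR` for the gauge defect). -/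
theorem c11_symMσGAt_βg (ρ : Fin d → ℤ) (Z Zb' Z₀ Zb₀ : Form1 d (Tau 𝔸)) (W V : Form1 d 𝔸) (L : ℕ) (μ : Fin d) (y : Fin d → ℤ) :
    c11 (symMσGAt 𝕜 ρ Z Zb' (βg lam D W V) Z₀ Zb₀ 0 L μ y)
      = c01 (symMσGAt 𝕜 ρ Z Zb' (upF (βg1 lam D W)) Z₀ Zb₀ 0 L μ y)
        + c10 (symMσGAt 𝕜 ρ Z Zb' (upF (βg2 lam D V)) Z₀ Zb₀ 0 L μ y)
        + c00 (symMσGAt 𝕜 ρ Z Zb' (upF (βg3 (𝕜 := 𝕜) lam D W V)) Z₀ Zb₀ 0 L μ y) := by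
  have e1 : (fun κ x => τ₁ * ι (βg1 lam D W κ x)) = fun κ x => τ₁ * upF (βg1 lam D W) κ x := rfl
  have e2 : (fun κ x => τ₂ * ι (βg2 lam D V κ x)) = fun κ x => τ₂ * upF (βg2 lam D V) κ x := rfl
  have e3 : (fun κ x => τ12 * ι (βg3 (𝕜 := 𝕜) lam D W V κ x)) = fun κ x => τ12 * upF (βg3 (𝕜 := 𝕜) lam D W V) κ x := rfl
  rw [βg_eq, symMσGAt_add_zero, symMσGAt_add_zero, e1, e2, e3, symMσGAt_mul_central_zero τ₁ τ₁_comm, symMσGAt_mul_central_zero τ₂ τ₂_comm,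
    symMσGAt_mul_central_zero τ12 τ12_comm, c11_add, c11_add, c11_τ₁_mul, c11_τ₂_mul, c11_τ12_mul]

/-- [folklore] **THE JET WARD IDENTITY OF node 12b's ROOTED MIXED JET, IN COUNTS** (`(L:𝕜) ≠ 0`, characteristic ≠ 2): for the pure-gauge
background `(dλ)_f·D`,
`M^ρ_b(W, V; dλ·D) = (2(d!)²L^d)⁻¹•(symHessUAt ρ V β₁ + (d ! : ℤ) • symLinU ρ [V, β₁] + symHessUAt ρ W β₂ + (d ! : ℤ) • symLinU ρ [W, β₂]) + (d!·L^d)⁻¹•symLinU ρ β₃ − (a_r·H − H·a_r)`,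
`a_r = λ(r)·D` at the ROOT `r = L·y + ρ`, `H = (2(d!)²L^d)⁻¹•symHessUAt ρ W V` (33M3a), `β₁ = [a,W]`, `β₂ = [a,V]`, `β₃ = ha + ah − WaV − VaW`. -/
theorem symMjetAt_gauge_counts {L : ℕ} (hd : ((d ! : ℕ) : 𝕜) ≠ 0) (hL : (L : 𝕜) ≠ 0) (h2 : (2 : 𝕜) ≠ 0) (ρ : Fin d → ℤ) (W V : Form1 d 𝔸) (μ : Fin d)
    (y : Fin d → ℤ) :
    symMjetAt 𝕜 ρ W V (fun κ x => (lam (x + unitVec κ) - lam x) • D) L μ y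
      = ((2 : 𝕜) * ((d ! : 𝕜) ^ 2 * (L : 𝕜) ^ d))⁻¹ •
            (symHessUAt ρ V (βg1 lam D W) L μ y + (d ! : ℤ) • symLinU ρ (bw V (βg1 lam D W)) L μ y)
        + ((2 : 𝕜) * ((d ! : 𝕜) ^ 2 * (L : 𝕜) ^ d))⁻¹ •
            (symHessUAt ρ W (βg2 lam D V) L μ y + (d ! : ℤ) • symLinU ρ (bw W (βg2 lam D V)) L μ y)
        + ((d ! : 𝕜) * (L : 𝕜) ^ d)⁻¹ • symLinU ρ (βg3 (𝕜 := 𝕜) lam D W V) L μ y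
        - ((lam ((L : ℤ) • y + ρ) • D) * (((2 : 𝕜) * ((d ! : 𝕜) ^ 2 * (L : 𝕜) ^ d))⁻¹ • symHessUAt ρ W V L μ y)
            - (((2 : 𝕜) * ((d ! : 𝕜) ^ 2 * (L : 𝕜) ^ d))⁻¹ • symHessUAt ρ W V L μ y) * (lam ((L : ℤ) • y + ρ) • D)) := by
  rw [symMjetAt_eq_symMjetLAt, symMjetLAt_eq_c11, symMσLAt_eq_symMσGAt, ← symMσLAt_eq_symMσGAt, ← dS_eq_upF, symMσLAt_dS lam D h2 ρ W V (upF 0) L μ y,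
    c11_sub, c11_symMσGAt_βg, c01_symMσGAt_contact ρ W V _ hd hL h2, c10_symMσGAt_contact ρ W V _ hd hL h2, c00_symMσGAt_contact ρ W V _ hd hL,
    c11_sub, c11_ι_mul, c11_mul_ι, c11_logT_symPhiGAt_Zf ρ W V hd hL h2]

end Counts

end Summit.QuantumFields.BalabanUV.Beta.SymMixedJetWard
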